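import Mathlib.Data.Real.Basic
import Mathlib.Tactic.Linarith
import Mathlib.Tactic.Ring
import Mathlib.Tactic.Positivity
import HarnessLib

/-!
# QUANT lane R8, T-DEC, leg (III), blob case — the thin regime of `MixLawCellPDear`: the side bound `g ≥ ⅔(1 − δ)` DERIVED EXACTLY
# (one of the two inputs of `thinC1'_of_bounds`, `…QuantGatedSliceMixLawThinC1`)

builds on p205010 (kernel theorem, internal audit signed; external expert review pending)

Support file (`--supports stmt-CriticalPhenomena-4575`), QUANT lane lead seat prim-quant-lead (gen 33), rung R8 of
`run/shared/lean/prim/quant/LADDER.md`.  Memo: arm-2 g36 `…/prim-quant-arm-2-g36/THIN-REGIME-G36.md` §5 ('(g-low) g ≳ ⅔(1−δ)'); lead g33 NOTES.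
Pure real arithmetic, standard axioms, no sorries.

THE BOUND.  In the thin regime of `mixLawCellPDear_of_thinKink` (`…QuantGatedSliceMixLawPDearThin`) one has B₂ > 0, i.e.
`(t − 2k₁)(1 − y) < y(k₂ + a − t)`, the threshold `y ≤ (1−z)g`, and the frame `2(k₁ + a) < t < k₁ + k₂`.  With `1 − δ = (t − 2k₁)/(k₂ − k₁)`:
`t − 2k₁ < y(k₂ + a − 2k₁) ≤ (1−z)g·(k₂ + a − 2k₁)` and `2a < k₂ − k₁` give `2(t − 2k₁) ≤ 3g(k₂ − k₁)`, i.e. `g ≥ ⅔(1 − δ)` — EXACTLY, no rounding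
(arm-2 measured g − ⅔(1−δ) ≥ 0.05 on the regime).  The companion δ-bound (`δ ≥ 1 − (3/2)λ`, measured tight) is NOT derived here: the exact identity is
`δ = 1 − (1−z)λ + (k₁(1+z) − ag(1−z))/(k₂ − k₁)` and needs an upper bound on `ag(1−z)` from B₂ > 0 ∧ `y·k₂ ≤ S` (next seat).

* `LawDec.thin_g_low` — `2(t − 2k₁) ≤ 3g(k₂ − k₁)` on the thin regime.
* `LawDec.thin_delta_identity` — `(k₂ − k₁)·δ = (k₂ − k₁)(1 − (1−z)λ) + k₁(1+z) − ag(1−z)` (bookkeeping for the δ-bound).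

[this work]; regime and plan: arm-2 g36.  Nothing here is cited as a published result.
-/

namespace Summit.CriticalPhenomena.PercolationContinuityZ3.Theorems

namespace Quant

namespace LawDec

/-- **g-low on the thin regime**: `B₂ > 0` (`(t−2k₁)(1−y) < y(k₂+a−t)`), `0 < y ≤ 1`, `y ≤ (1−z)g`, `0 ≤ z`, `0 ≤ g`, `0 ≤ a`, `0 ≤ k₁`, `2(k₁+a) < t < k₁+k₂`
⟹ `2(t − 2k₁) ≤ 3g(k₂ − k₁)`. [this work] -/
theorem thin_g_low (y z g t k₁ k₂ a : ℝ) (hy0 : 0 < y) (hy1 : y ≤ 1) (hz0 : 0 ≤ z) (hg0 : 0 ≤ g) (hyg : y ≤ (1 - z) * g)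
    (ha : 0 ≤ a) (hk₁ : 0 ≤ k₁) (hllow : 2 * (k₁ + a) < t) (hcomp : t < k₁ + k₂)
    (hB2 : (t - 2 * k₁) * (1 - y) < y * (k₂ + a - t)) :
    2 * (t - 2 * k₁) ≤ 3 * g * (k₂ - k₁) := by
  -- t − 2k₁ < y (k₂ + a − 2k₁) ≤ g (k₂ + a − 2k₁)
  have hp0 : 0 ≤ t - 2 * k₁ := by linarith
  have h1 : t - 2 * k₁ < y * (k₂ + a - 2 * k₁) := by nlinarith
  have hyg' : y ≤ g := by nlinarith
  have hpos : 0 < y * (k₂ + a - t) := lt_of_le_of_lt (mul_nonneg hp0 (by linarith)) hB2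
  have hw0 : 0 < k₂ + a - t := by
    by_contra hc
    have : y * (k₂ + a - t) ≤ 0 := mul_nonpos_of_nonneg_of_nonpos hy0.le (not_lt.1 hc)
    linarith
  have hw : 0 ≤ k₂ + a - 2 * k₁ := by linarith
  have h2 : y * (k₂ + a - 2 * k₁) ≤ g * (k₂ + a - 2 * k₁) := mul_le_mul_of_nonneg_right hyg' hw
  -- 2a < k₂ − k₁ and a − 2k₁... : 2(k₂ + a − 2k₁) ≤ 3(k₂ − k₁) ⟸ 2a − k₁ ≤ k₂ − k₁... i.e. 2a ≤ k₂ ✓ (2a < k₂ − k₁ ≤ k₂)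
  have h3 : 2 * (k₂ + a - 2 * k₁) ≤ 3 * (k₂ - k₁) := by nlinarith
  nlinarith [mul_le_mul_of_nonneg_left h3 hg0]

/-- **the δ identity**: with `S = (1−z)(k₁ + (k₂−k₁)λ)`, `t = S + ag(1−z)` and `(k₂−k₁)δ = k₂ + k₁ − t`:
`(k₂ − k₁)δ = (k₂ − k₁)(1 − (1−z)λ) + k₁(1+z) − ag(1−z)`. [this work] -/
theorem thin_delta_identity (z g lam S t k₁ k₂ a : ℝ) (hmean : (1 - z) * (k₁ + (k₂ - k₁) * lam) = S)
    (ht : t = S + a * g * (1 - z)) :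
    k₂ + k₁ - t = (k₂ - k₁) * (1 - (1 - z) * lam) + k₁ * (1 + z) - a * g * (1 - z) := by
  rw [ht, ← hmean]; ring

end LawDec

end Quant

end Summit.CriticalPhenomena.PercolationContinuityZ3.Theorems
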